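import Mathlib
import HarnessLib
import Summits.HubbardSuperconductivity.HubbardSuperconductivity.Theorems.KLProgrammeKLRegimeThinMultiplierIncrementPairTime
import Summits.HubbardSuperconductivity.HubbardSuperconductivity.Theorems.KLProgrammeKLRegimeThinMultiplierIncrementPairSymbol
import Summits.HubbardSuperconductivity.HubbardSuperconductivity.Theorems.KLProgrammeKLRegimeFatMultiplierIncrementRelJetsScaleData

/-!
# K3 VL child `KLRegimeVolumeLimitV17F2` (stmt-HubbardSuperconductivity-20440), located item #23 «W2-HALF-VL», brick «W2H-OVL» part 10 (SCALE, time/sup): the THIN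
# increment pair `(F^{K_o}_{n_a,ω_a} − F^{K}_{n_a,ω_a})·F^{K}_{n_b,ω_b}` — amplitude `𝔅₀(x)` and time differences `≤ 𝔅₀(x)·θ_k`

Cell `gate-hubbard-kl`, seat p3 (g14), lead of #23; THIN twin of the amplitude/time part of k3c3-p2's `…FatMultiplierIncrementPairScaleTime` (p595149):
`norm_thinIncrPairSymbol_le` (sup) and `norm_fwdDiff_iter_time_thinIncrPair_le` (T2) ∘ k3c3-p2's `incrPair_time_rel_le` (`…IncrementRelJetsScaleData`), in the
two-scale class of a flow piece at depth `x` (`|ν| ≤ G₀/x²`):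

* **`thinIncrPair_ampTime_data`** — (1) `‖Gs^Δ‖ ≤ 𝔅₀(x) = C₁·(G₀/x²)(2(Λ_a+G₀/x²)+G₀/x²)` (`C₁ = de₀²/Λ_a²`, `Λ_a = klScale e₀ n_a`); (2) time differences
  `≤ 𝔅₀(x)·θ_k`, `k = 1,2,3`, `θ₁ = κD₁ᵗ + q₁ᵗ`, `θ₂ = κ²(D₁ᵗ)² + κD₂ᵗ + 2κD₁ᵗq₁ᵗ + q₂ᵗ`, `θ₃ = …` (`κ = e₀²/Λ_a²`, `D₁ᵗ = 2Λ_a|2π/β|`, `D₂ᵗ = 2(2π/β)²`,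
  `q_kᵗ` the co-factor profile's time jets at scale `Λ_b = klScale e₀ n_b`; `x`-free), under the window `Λ_aβ < π(2M−5)`.
(The support count of the thin-pair DIFFERENCE is k3c4-p2's `card_support_thinPairDiff_le`; the cell / tangency data enter `…ThinPairDiffWt` as hypotheses.)

Everything is proved; no definitions, no sorry.  Nothing asserts any stub, K3, VL or superconductivity. [cite: BenfattoGiulianiMastropietro2006, §2.5 (2.52), (2.56), §2.7 (2.71a), §3 (3.2)]
-/

noncomputable section

namespace Summit.HubbardSuperconductivity.HubbardSuperconductivity.Theorems.TorusFourierL2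

set_option linter.dupNamespace false -- summit = problem name (single-conjunct summit), D-0017

open Set Finset Filter Topology Literature.MathematicalPhysics.QuantumLattice Literature.MathematicalPhysics.QuantumLattice.BandSectorCounting
open Literature.MathematicalPhysics.QuantumLattice.FermiRG Literature.Probability.LatticeModels Literature.Analysis.SpecialFunctions Literature.Analysis.Calculus
open Summit.HubbardSuperconductivity.HubbardSuperconductivity.Theorems.DispersionFlow
open Summit.HubbardSuperconductivity.HubbardSuperconductivity.Theorems.KLRegimeSplit
open Summit.HubbardSuperconductivity.HubbardSuperconductivity.Theorems.KLProgrammeLegKernels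
open Summit.HubbardSuperconductivity.HubbardSuperconductivity.Theorems.PerturbedFermiCurve
open scoped Real Nat

section ThinAmpTime

open Classical

variable {L M : ℕ} [NeZero L] [NeZero M] {K : TrigPolyC4v} (Ko : TrigPolyC4v) {A : ℝ}
  (hA : ∀ p : Momentum, ∀ j ≤ 2, ‖iteratedFDeriv ℝ j (frameShift K) p‖ ≤ A)
  {μ e₀ z β : ℝ} (he : 0 < e₀) (hz : 0 < z) (h3 : e₀ + A - μ ≤ 3) (hβ : 0 < β)
  (na nb : ℕ) (hMm : klScale e₀ na * β < π * (2 * M - 5))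
  {d : ℝ} (hd1 : ∀ u, |deriv (bgmCutoffSq e₀) u| ≤ d) (hd2 : ∀ u, |iteratedDeriv 2 (bgmCutoffSq e₀) u| ≤ d)
  (hd3 : ∀ u, |iteratedDeriv 3 (bgmCutoffSq e₀) u| ≤ d) (hd4 : ∀ u, |iteratedDeriv 4 (bgmCutoffSq e₀) u| ≤ d)
  -- the piece `ν = e_K − e_{K_o}` at depth `x`
  {ν : (Fin 2 → ℝ) → ℝ} (hν : ∀ p, ν p = frameLevel μ K (WithLp.toLp 2 p) - frameLevel μ Ko (WithLp.toLp 2 p))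
  {x G₀ : ℝ} (hx : 1 ≤ x) (hN₀ : ∀ p, |ν p| ≤ G₀ / x ^ 2)
  -- the names (instantiate with `rfl`)
  {κ C₁ B₀x qt₁ qt₂ qt₃ Dt₁ Dt₂ θ₁ θ₂ θ₃ : ℝ}
  (hκ : κ = e₀ ^ 2 / klScale e₀ na ^ 2) (hC₁ : C₁ = d * e₀ ^ 2 / klScale e₀ na ^ 2)
  (hB₀x : B₀x = C₁ * (G₀ / x ^ 2 * (2 * (klScale e₀ na + G₀ / x ^ 2) + G₀ / x ^ 2)))
  (hqt₁ : qt₁ = 2 * (d * e₀ ^ 2) * |2 * π / β| / klScale e₀ nb) (hqt₂ : qt₂ = (4 * (d * e₀ ^ 4) + 2 * (d * e₀ ^ 2)) * (2 * π / β) ^ 2 / klScale e₀ nb ^ 2)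
  (hqt₃ : qt₃ = (8 * (d * e₀ ^ 6) + 12 * (d * e₀ ^ 4)) * |2 * π / β| ^ 3 / klScale e₀ nb ^ 3)
  (hDt₁ : Dt₁ = 2 * klScale e₀ na * |2 * π / β|) (hDt₂ : Dt₂ = 2 * (2 * π / β) ^ 2)
  (hθ₁ : θ₁ = κ * Dt₁ + qt₁) (hθ₂ : θ₂ = κ ^ 2 * Dt₁ ^ 2 + κ * Dt₂ + 2 * (κ * Dt₁) * qt₁ + qt₂)
  (hθ₃ : θ₃ = κ ^ 3 * Dt₁ ^ 3 + 3 * (κ ^ 2 * (Dt₁ * Dt₂)) + 3 * ((κ ^ 2 * Dt₁ ^ 2 + κ * Dt₂) * qt₁) + 3 * (κ * Dt₁ * qt₂) + qt₃)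

include hA he hz h3 hβ hMm hd1 hd2 hd3 hd4 hν hx hN₀ hκ hC₁ hB₀x hqt₁ hqt₂ hqt₃ hDt₁ hDt₂ hθ₁ hθ₂ hθ₃ in
set_option maxHeartbeats 1600000 in
/-- **Amplitude and time differences of the THIN increment pair in the two-scale class** (see the module docstring).
[cite: BenfattoGiulianiMastropietro2006, §2.5 (2.52), (2.56), §2.7 (2.71a), §3 (3.2)] -/
theorem thinIncrPair_ampTime_data (ωa : Fin (sectorCount na)) (ωb : Fin (sectorCount nb)) (Gs : TorusSite 1 (2 * M) × TorusSite 2 L → ℂ)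
    (hGsdef : Gs = fun q => klAnisoFamily L M β μ Ko e₀ na ωa (⟨(q.1 0).val, ZMod.val_lt (q.1 0)⟩, q.2) *
        klAnisoFamily L M β μ K e₀ nb ωb (⟨(q.1 0).val, ZMod.val_lt (q.1 0)⟩, q.2) -
      klAnisoFamily L M β μ K e₀ na ωa (⟨(q.1 0).val, ZMod.val_lt (q.1 0)⟩, q.2) *
        klAnisoFamily L M β μ K e₀ nb ωb (⟨(q.1 0).val, ZMod.val_lt (q.1 0)⟩, q.2)) :
    (∀ q, ‖Gs q‖ ≤ B₀x) ∧
    (∀ q, ‖fwdDiff ((fun _ : Fin 1 => (1 : ZMod (2 * M))), (0 : TorusSite 2 L)) Gs q‖ ≤ B₀x * θ₁) ∧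
    (∀ q, ‖(fwdDiff ((fun _ : Fin 1 => (1 : ZMod (2 * M))), (0 : TorusSite 2 L)))^[2] Gs q‖ ≤ B₀x * θ₂) ∧
    (∀ q, ‖(fwdDiff ((fun _ : Fin 1 => (1 : ZMod (2 * M))), (0 : TorusSite 2 L)))^[3] Gs q‖ ≤ B₀x * θ₃) ∧
    (0 ≤ B₀x ∧ 0 ≤ θ₁ ∧ 0 ≤ θ₂ ∧ 0 ≤ θ₃) := by
  have hL : (0 : ℝ) < L := Nat.cast_pos.2 (Nat.pos_of_ne_zero (NeZero.ne L))
  have hπ := Real.pi_pos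
  have hΛ : 0 < klScale e₀ na := by rw [klScale]; positivity
  have hΛb : 0 < klScale e₀ nb := by rw [klScale]; positivity
  have hx0 : 0 < x := lt_of_lt_of_le one_pos hx
  have hd0 : 0 ≤ d := (abs_nonneg _).trans (hd1 0)
  have hG00 : 0 ≤ G₀ := by
    have h := hN₀ 0
    have : 0 ≤ G₀ / x ^ 2 := (abs_nonneg _).trans h
    have hx2 : 0 < x ^ 2 := by positivity
    by_contra hneg
    push Not at hneg
    have : G₀ / x ^ 2 < 0 := div_neg_of_neg_of_pos hneg hx2
    linarith
  -- the objects
  obtain ⟨Z, hZdef⟩ : ∃ Z : (Fin 2 → ℝ) → ℝ, Z = fun p => gnCutoff ((π + z) ^ 2 / π ^ 2) ((π + z) ^ 2) (p 0 ^ 2) * gnCutoff ((π + z) ^ 2 / π ^ 2) ((π + z) ^ 2) (p 1 ^ 2) *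
    ((radialCutoffC (1 / 2) (momToComplex p) * sectorWeightCirc na ((ωa : ℕ) : ℤ) (polarAngle p)) *
      (radialCutoffC (1 / 2) (momToComplex p) * sectorWeightCirc nb ((ωb : ℕ) : ℤ) (polarAngle p))) := ⟨_, rfl⟩
  have hZ : ∀ p, Z p = gnCutoff ((π + z) ^ 2 / π ^ 2) ((π + z) ^ 2) (p 0 ^ 2) * gnCutoff ((π + z) ^ 2 / π ^ 2) ((π + z) ^ 2) (p 1 ^ 2) *
    ((radialCutoffC (1 / 2) (momToComplex p) * sectorWeightCirc na ((ωa : ℕ) : ℤ) (polarAngle p)) *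
      (radialCutoffC (1 / 2) (momToComplex p) * sectorWeightCirc nb ((ωb : ℕ) : ℤ) (polarAngle p))) := fun p => by rw [hZdef]
  obtain ⟨Φ, hΦdef⟩ : ∃ Φ : ℝ × (Fin 2 → ℝ) → ℂ, Φ = fun y => (((bgmCutoffSq e₀ ((16 : ℝ) ^ na * (y.1 ^ 2 + (frameLevel μ K (WithLp.toLp 2 y.2) - ν y.2) ^ 2)) -
      bgmCutoffSq e₀ ((16 : ℝ) ^ na * (y.1 ^ 2 + frameLevel μ K (WithLp.toLp 2 y.2) ^ 2))) *
      (bgmCutoffSq e₀ ((16 : ℝ) ^ nb * (y.1 ^ 2 + frameLevel μ K (WithLp.toLp 2 y.2) ^ 2)) * Z y.2) : ℝ) : ℂ) := ⟨_, rfl⟩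
  have hΦ : ∀ k₀ p, Φ (k₀, p) = (((bgmCutoffSq e₀ ((16 : ℝ) ^ na * (k₀ ^ 2 + (frameLevel μ K (WithLp.toLp 2 p) - ν p) ^ 2)) -
      bgmCutoffSq e₀ ((16 : ℝ) ^ na * (k₀ ^ 2 + frameLevel μ K (WithLp.toLp 2 p) ^ 2))) *
      (bgmCutoffSq e₀ ((16 : ℝ) ^ nb * (k₀ ^ 2 + frameLevel μ K (WithLp.toLp 2 p) ^ 2)) * Z p) : ℝ) : ℂ) := fun k₀ p => by rw [hΦdef]
  have hGsΦ : ∀ q, Gs q = Φ (π * (1 - 2 * M) / β + 2 * π / β * (((q.1 0).val : ℕ) : ℝ), fun j => 2 * π / L * (((q.2 j).valMinAbs : ℤ) : ℝ)) := by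
    intro q'; rw [hGsdef]
    exact klAnisoIncr_mul_klAniso_eq_symbol Ko hA he hz h3 ωa ωb hZ hν hΦ q'
  -- (1) the sup
  have hsup : ∀ q, ‖Gs q‖ ≤ B₀x := fun q => by
    rw [hGsΦ, hB₀x, hC₁]
    have h := norm_thinIncrPairSymbol_le (K := K) (μ := μ) he (na := na) (nb := nb) ωa ωb hZ hd1 hd2 hd3 hN₀ hΦ
      (π * (1 - 2 * M) / β + 2 * π / β * (((q.1 0).val : ℕ) : ℝ)) (fun j => 2 * π / L * (((q.2 j).valMinAbs : ℤ) : ℝ))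
    refine h.trans (le_of_eq ?_)
    ring
  -- (2) the time instance, exact brackets
  have htime := fun q => norm_fwdDiff_iter_time_thinIncrPair_le he hβ na nb hd1 hd2 hd3 hd4 hZ hN₀ hΦ hGsΦ hMm
    rfl rfl rfl rfl rfl rfl rfl rfl rfl rfl rfl rfl rfl rfl rfl q
  have hκ0 : 0 ≤ κ := by rw [hκ]; positivity
  have hqt₁0 : 0 ≤ qt₁ := by rw [hqt₁]; positivity
  have hqt₂0 : 0 ≤ qt₂ := by rw [hqt₂]; positivity
  have hqt₃0 : 0 ≤ qt₃ := by rw [hqt₃]; positivity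
  have hDt₁0 : 0 ≤ Dt₁ := by rw [hDt₁]; positivity
  have hDt₂0 : 0 ≤ Dt₂ := by rw [hDt₂]; positivity
  have hθ₁0 : 0 ≤ θ₁ := by rw [hθ₁]; positivity
  have hθ₂0 : 0 ≤ θ₂ := by rw [hθ₂]; positivity
  have hθ₃0 : 0 ≤ θ₃ := by rw [hθ₃]; positivity
  have hB₀x0 : 0 ≤ B₀x := by rw [hB₀x, hC₁]; positivity
  have hrel : ∀ q, ‖fwdDiff ((fun _ : Fin 1 => (1 : ZMod (2 * M))), (0 : TorusSite 2 L)) Gs q‖ ≤ B₀x * θ₁ ∧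
      ‖(fwdDiff ((fun _ : Fin 1 => (1 : ZMod (2 * M))), (0 : TorusSite 2 L)))^[2] Gs q‖ ≤ B₀x * θ₂ ∧
      ‖(fwdDiff ((fun _ : Fin 1 => (1 : ZMod (2 * M))), (0 : TorusSite 2 L)))^[3] Gs q‖ ≤ B₀x * θ₃ := by
    intro q
    obtain ⟨t₁, t₂, t₃⟩ := htime q
    have h := incrPair_time_rel_le (κ := κ) (C₁ := d * e₀ ^ 2 / klScale e₀ na ^ 2) (C₂ := d * e₀ ^ 4 / klScale e₀ na ^ 4)
      (C₃ := d * e₀ ^ 6 / klScale e₀ na ^ 6) (C₄ := d * e₀ ^ 8 / klScale e₀ na ^ 8)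
      (W₀ := G₀ / x ^ 2 * (2 * (klScale e₀ na + G₀ / x ^ 2) + G₀ / x ^ 2)) (D₁ := 2 * klScale e₀ na * |2 * π / β|) (D₂ := 2 * (2 * π / β) ^ 2)
      (q₁ := 2 * (d * e₀ ^ 2) * |2 * π / β| / klScale e₀ nb) (q₂ := (4 * (d * e₀ ^ 4) + 2 * (d * e₀ ^ 2)) * (2 * π / β) ^ 2 / klScale e₀ nb ^ 2)
      (q₃ := (8 * (d * e₀ ^ 6) + 12 * (d * e₀ ^ 4)) * |2 * π / β| ^ 3 / klScale e₀ nb ^ 3)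
      (by rw [hκ]; field_simp) (by rw [hκ]; field_simp) (by rw [hκ]; field_simp) rfl rfl rfl rfl t₁ t₂ t₃
      (θ₁ := θ₁) (θ₂ := θ₂) (θ₃ := θ₃) (by rw [hθ₁, hDt₁, hqt₁]) (by rw [hθ₂, hDt₁, hDt₂, hqt₁, hqt₂]) (by rw [hθ₃, hDt₁, hDt₂, hqt₁, hqt₂, hqt₃])
    rw [← hC₁, ← hB₀x] at h
    exact h
  exact ⟨hsup, fun q => (hrel q).1, fun q => (hrel q).2.1, fun q => (hrel q).2.2, ⟨hB₀x0, hθ₁0, hθ₂0, hθ₃0⟩⟩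

end ThinAmpTime

end Summit.HubbardSuperconductivity.HubbardSuperconductivity.Theorems.TorusFourierL2

end
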